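import Mathlib
import Summits.NavierStokesRegularity.NavierStokesRegularity.Theorems.EulerZoomLiouvillePowerGaugeEulerLiouvilleSelfSimilarTopBadNodeArcDynamics
import Summits.NavierStokesRegularity.NavierStokesRegularity.Theorems.EulerZoomLiouvillePowerGaugeEulerLiouvilleSelfSimilarTopBadNodeArcSpectral
import Summits.NavierStokesRegularity.NavierStokesRegularity.Theorems.EulerZoomLiouvillePowerGaugeEulerLiouvilleSelfSimilarTopBadNodeThresholdCone
import Summits.NavierStokesRegularity.NavierStokesRegularity.Theorems.EulerZoomLiouvillePowerGaugeEulerLiouvilleSelfSimilarTopBadNodeExitTools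
import HarnessLib.Audit

/-!
# Rung C1 of the crux `EulerZoomLiouville.PowerGaugeEulerLiouville`: the no-exit lemma, CASE (T) — THRESHOLD REACHED
# (blueprint §2, `false_of_exit_threshold`)

Route №10 `EulerZoomLiouville` (NavierStokesRegularity), crux E = stmt-NavierStokesRegularity-19832,
tenure rung C1 (exactly self-similar members), registered residue `stub_selfSimilarExtremal`.
Twenty-fifth file of the NODAL-CONTINUUM line (lineage ns-typeII-p1, gen 7).  Setting of the no-exit lemma at the
degenerate top bad node `z` (`0 < γ < ½`, `C²` profile): kernel graph `τ ↦ z + τe + g(τ)` with `V = φe` on it, a backward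
trajectory `Y` on `[0, t₁]` that starts `ε`-close to `z`, stays in `B̄(z, r)` and exits at `t₁` at a vortical point
(`ℋ(Y t₁) < ℋ(z)`), tube coordinates `σ, ξ` and the eigenframe splitting `p + m = |ξ|²` of `tube_inequalities`,
trajectory maximum `M₁ ≥ |φ∘σ|`, threshold `Θ = κM₁² + 9(1+K)ε²`.  The hypotheses are the COMMON HYPOTHESES of the
blueprint (evidence NO-EXIT-BLUEPRINT on the crux item), verbatim.

* `false_of_exit_threshold` — if `p + m ≥ 2(1+K)Θ` at some time `≤ t₁`, contradiction: `cone_of_threshold` puts the exit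
  in the cone with `m ≥ 2Θ`, the transversal Bernoulli gain `(1−2γ)(μ/8)|ξ₁|²` (off-node expansion `hexp` at `Γ(σ₁)`)
  beats the off-node error (`ν`, `Cν|φ(σ₁)|`), the linear term `|Dℋ(Γσ₁)ξ₁| ≤ M₁η|ξ₁|` (since `|ξ₁|² ≥ 2κM₁²`), and the
  landscape deficit `ℋ(Γσ₁) − ℋ(z) ≥ −3(1−2γ)C₁ε³/2 − 3ρ²C₃ε²/μ²` (`selfSimilarBernoulli_graph_gain`, speed-square budget
  `bernoulli_comp_sub_eq`, `|V(Y)| ≥ (μ/2)|ξ|` by `norm_apply_ge_of_eigen`) (since `|ξ₁|² ≥ 18(1+K)ε²`) — so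
  `ℋ(Y t₁) > ℋ(z)`.

WHAT THIS IS NOT: not NS, not E, not yet the no-exit lemma — one of its three cases.
[cite: ConstantinIgnatovaVicol2026Putative, §3.4.3–§3.5, §4 (local analysis not in print)] [cite: KatokHasselblatt1995, §6.2]
-/

noncomputable section

-- flat `Theorems/<Route><Decl>…` files of one crux share the namespace of the crux (tree convention)
set_option linter.dupNamespace false

open Set Filter Topology Metric Function InnerProductSpace MeasureTheory intervalIntegral
open scoped RealInnerProductSpace NNReal

namespace Summit.NavierStokesRegularity.NavierStokesRegularity.Theorems.PowerGaugeEulerLiouville.NodalContinuum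

open Literature.Analysis Literature.Analysis.FluidPDE Literature.Analysis.ODE
open Summit.NavierStokesRegularity.NavierStokesRegularity.Theorems.PowerGaugeEulerLiouville.NodalFiniteness

variable {γ C : ℝ} {c : EuclideanSpace ℝ (Fin 3)}
  {U : EuclideanSpace ℝ (Fin 3) → EuclideanSpace ℝ (Fin 3)} {P : EuclideanSpace ℝ (Fin 3) → ℝ}

set_option maxHeartbeats 800000 in
/-- **CASE (T) of the no-exit lemma: threshold reached ⇒ contradiction.**  See the module docstring; hypotheses = the
blueprint's COMMON HYPOTHESES + the case data `2(1+K)Θ ≤ p(t) + m(t)`.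
[cite: ConstantinIgnatovaVicol2026Putative, §3.4.3–§3.5, §4 (local analysis not in print)] [cite: KatokHasselblatt1995, §6.2 (cone criterion)] -/
theorem false_of_exit_threshold (h : IsSelfSimilarEulerProfile γ c U P) (hγ : 0 < γ) (hγ2 : γ < 1 / 2)
    {z : EuclideanSpace ℝ (Fin 3)} (hΩz : curl U z = 0)
    {e : EuclideanSpace ℝ (Fin 3)} (he1 : ‖e‖ = 1) (hAe : fderiv ℝ (selfSimilarTransport γ c U) z e = 0)
    -- spectral data of `A = DV(z)` (`exists_spectralData_of_badNode`), `K = 2α/μ + 1`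
    {b : OrthonormalBasis (Fin 3) ℝ (EuclideanSpace ℝ (Fin 3))} {a : Fin 3 → ℝ} {μ α K : ℝ}
    (hb : ∀ i, fderiv ℝ (selfSimilarTransport γ c U) z (b i) = a i • b i) (hμ : 0 < μ) (hμα : μ ≤ α)
    (hpos_i : ∀ i, 0 < a i → μ ≤ a i)
    (hneg_i : ∀ ξ : EuclideanSpace ℝ (Fin 3), ⟪e, ξ⟫ = 0 → ∀ i, ¬ 0 < a i → a i ≤ -μ ∨ ⟪b i, ξ⟫ = 0)
    (hK : K = 2 * α / μ + 1)
    -- the kernel graph `τ ↦ z + τe + g τ` (`|τ| ≤ δ`), `V = φ e` on it, `C^{1,1}` bounds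
    {g g' : ℝ → EuclideanSpace ℝ (Fin 3)} {φ : ℝ → ℝ} {δ L C₁ : ℝ} (hL : 0 ≤ L) (hC₁ : 0 ≤ C₁)
    (hg0 : g 0 = 0) (hge : ∀ τ, ⟪e, g τ⟫ = 0) (hgd : ∀ τ, HasDerivAt g (g' τ) τ)
    (hg' : ∀ τ, |τ| ≤ δ → ‖g' τ‖ ≤ L * |τ|)
    (hpar : ∀ τ, |τ| ≤ δ → selfSimilarTransport γ c U (z + τ • e + g τ) = φ τ • e)
    (hφc : Continuous φ) (hφsq : ∀ τ, |τ| ≤ δ → |φ τ| ≤ C₁ * τ ^ 2)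
    -- accuracies: two-point linearisation `ρ` on `B̄(z, δ)`, `DU`-oscillation `η` on `B̄(z, δ)`, off-node expansion (`ν`, `Cν`) on `B̄(z, δ)`
    {ρ η ν Cν : ℝ} (hρ : 0 < ρ) (hη : 0 < η) (hCν : 0 ≤ Cν)
    (hηU : ∀ y ∈ closedBall z δ, 2 * ‖fderiv ℝ U y - fderiv ℝ U z‖ ≤ η)
    (hexp : ∀ y : EuclideanSpace ℝ (Fin 3), ‖y - z‖ ≤ δ → ∀ ζ : EuclideanSpace ℝ (Fin 3), ‖ζ‖ ≤ δ →
      selfSimilarBernoulli γ c U P y + fderiv ℝ (selfSimilarBernoulli γ c U P) y ζ +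
          (1 / 2 * ((2 * γ - 1) * ⟪fderiv ℝ (selfSimilarTransport γ c U) z ζ, ζ⟫) -
            (ν + Cν * ‖selfSimilarTransport γ c U y‖) * ‖ζ‖ ^ 2) ≤
        selfSimilarBernoulli γ c U P (y + ζ))
    -- the trajectory on `[0, t₁]`: backward flow line from `Y 0`, inside `B̄(z, r)`, exit at `t₁`, vortical endpoint below `ℋ(z)`
    {Y : ℝ → EuclideanSpace ℝ (Fin 3)} {r ε C₃ t₁ : ℝ} (hr : 0 < r) (hrδ : 4 * r ≤ δ) (hε : 0 < ε) (hεr : ε ≤ r / 8)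
    (hY : ∀ t, HasDerivAt Y ((-1 : ℝ) • selfSimilarTransport γ c U (Y t)) t) (ht₁ : 0 < t₁)
    (hin : ∀ t ∈ Icc 0 t₁, ‖Y t - z‖ ≤ r) (hY0 : ‖Y 0 - z‖ < ε)
    (hHlt : selfSimilarBernoulli γ c U P (Y t₁) < selfSimilarBernoulli γ c U P z)
    (hH0 : selfSimilarBernoulli γ c U P z - C₃ * ε ^ 2 ≤ selfSimilarBernoulli γ c U P (Y 0))
    -- tube coordinates and the eigenframe splitting (`tube_inequalities` with `Λ = L r`)
    {σ p m pd md : ℝ → ℝ} {ξ : ℝ → EuclideanSpace ℝ (Fin 3)} (hσ : ∀ t, σ t = ⟪e, Y t - z⟫)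
    (hξ : ∀ t, ξ t = Y t - z - σ t • e - g (σ t))
    (hpm : ∀ t, p t + m t = ‖ξ t‖ ^ 2) (hpnn : ∀ t, 0 ≤ p t) (hmnn : ∀ t, 0 ≤ m t)
    (hp' : ∀ t, HasDerivAt p (pd t) t) (hm' : ∀ t, HasDerivAt m (md t) t)
    (hpd : ∀ t ∈ Icc 0 t₁, pd t ≤ -μ * p t + 18 * ρ ^ 2 / μ * (p t + m t) + 2 * (L * r) ^ 2 / μ * φ (σ t) ^ 2)
    (hmd : ∀ t ∈ Icc 0 t₁, μ * m t - 18 * ρ ^ 2 / μ * (p t + m t) - 2 * (L * r) ^ 2 / μ * φ (σ t) ^ 2 ≤ md t)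
    (hAξ : ∀ t, ⟪fderiv ℝ (selfSimilarTransport γ c U) z (ξ t), ξ t⟫ ≤ α * p t - μ * m t)
    (hE : ∀ t ∈ Icc 0 t₁, ‖selfSimilarTransport γ c U (Y t) - φ (σ t) • e -
      fderiv ℝ (selfSimilarTransport γ c U) z (ξ t)‖ ≤ ρ * ‖ξ t‖)
    -- the trajectory maximum of `|φ ∘ σ|` and the threshold `Θ`
    {M₁ Θ κ : ℝ} (hM₁ : ∀ t ∈ Icc 0 t₁, |φ (σ t)| ≤ M₁) (hM₁0 : 0 ≤ M₁)
    (hκ : κ = 512 * η ^ 2 / ((1 - 2 * γ) ^ 2 * μ ^ 2) + 16 * (1 + K) * (L * r) ^ 2 / μ ^ 2)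
    (hΘ : Θ = κ * M₁ ^ 2 + 9 * (1 + K) * ε ^ 2)
    -- accuracy conditions (functions of `μ, α, γ` only)
    (hρ1 : 18 * ρ ^ 2 / μ * (1 + K) ≤ μ / 16) (hρ2 : ρ ≤ μ / 2)
    (hν1 : ν ≤ (1 - 2 * γ) * μ / 64)
    -- case hypotheses and the smallness used here
    (hrCν : Cν * C₁ * r ^ 2 ≤ (1 - 2 * γ) * μ / 64) (hrθ : η * (1 + 2 * L * r) ≤ (1 - 2 * γ) / 2) (hLr : L * r ≤ 1 / 4)
    (hεT : 3 * (1 - 2 * γ) * C₁ * ε / 2 + 3 * ρ ^ 2 * C₃ / μ ^ 2 ≤ (1 - 2 * γ) * μ / 32 * (18 * (1 + K)))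
    {t : ℝ} (ht : t ∈ Icc 0 t₁) (hbig : 2 * (1 + K) * Θ ≤ p t + m t) : False := by
  classical
  set V := selfSimilarTransport γ c U with hV
  set A : EuclideanSpace ℝ (Fin 3) →L[ℝ] EuclideanSpace ℝ (Fin 3) := fderiv ℝ V z with hAdef
  set Hb := selfSimilarBernoulli γ c U P with hHb
  have h12 : 0 < 1 - 2 * γ := by linarith
  have hKge1 : 1 ≤ K := by
    have : 0 ≤ 2 * α / μ := div_nonneg (by linarith) hμ.le
    rw [hK]; linarith
  have hKpos : 0 < K := by linarith
  have hKα : α ≤ K * μ / 2 := by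
    rw [hK]
    have : (2 * α / μ + 1) * μ / 2 = α + μ / 2 := by field_simp
    rw [this]; linarith
  have hA : (A : EuclideanSpace ℝ (Fin 3) →ₗ[ℝ] EuclideanSpace ℝ (Fin 3)).IsSymmetric :=
    isSymmetric_fderiv_transport_of_curl_eq_zero h hΩz
  have hee : ⟪e, e⟫ = 1 := by rw [real_inner_self_eq_norm_sq, he1]; norm_num
  have hAe' : A e = 0 := hAe
  /- ── elementary geometry of the tube coordinates ── -/
  have hσle : ∀ t ∈ Icc 0 t₁, |σ t| ≤ r := fun t ht => by
    rw [hσ t]; exact ((abs_real_inner_le_norm e _).trans (by rw [he1, one_mul])).trans (hin t ht)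
  have hσδ : ∀ t ∈ Icc 0 t₁, |σ t| ≤ δ := fun t ht => (hσle t ht).trans (by linarith)
  have hLr4 : ∀ τ, |τ| ≤ r → ‖g τ‖ ≤ |τ| / 4 := by
    intro τ hτ
    have h1 : ‖g τ‖ ≤ L * τ ^ 2 := norm_graph_le_sq hL hg0 hgd hg' (hτ.trans (by linarith))
    have h2 : L * τ ^ 2 = (L * |τ|) * |τ| := by rw [mul_assoc, ← sq_abs]; ring
    have h3 : L * |τ| ≤ 1 / 4 := (mul_le_mul_of_nonneg_left hτ hL).trans hLr
    rw [h2] at h1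
    exact h1.trans ((mul_le_mul_of_nonneg_right h3 (abs_nonneg _)).trans_eq (by ring))
  have hΓz : ∀ τ, |τ| ≤ r → ‖τ • e + g τ‖ ≤ 2 * r := by
    intro τ hτ
    calc ‖τ • e + g τ‖ ≤ ‖τ • e‖ + ‖g τ‖ := norm_add_le _ _
      _ ≤ |τ| + |τ| / 4 := by rw [norm_smul, Real.norm_eq_abs, he1, mul_one]; exact add_le_add le_rfl (hLr4 τ hτ)
      _ ≤ 2 * r := by linarith
  have hξe : ∀ t, ⟪e, ξ t⟫ = 0 := by
    intro t; rw [hξ t, inner_sub_right, inner_sub_right, inner_smul_right, hee, hge, ← hσ t]; ring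
  have hYΓξ : ∀ t, Y t = (z + σ t • e + g (σ t)) + ξ t := by intro t; rw [hξ t]; abel
  have hξle : ∀ t ∈ Icc 0 t₁, ‖ξ t‖ ≤ 3 * r := by
    intro t ht
    have e1 : ξ t = (Y t - z) - (σ t • e + g (σ t)) := by rw [hξ t]; abel
    rw [e1]
    exact (norm_sub_le _ _).trans (by linarith [hin t ht, hΓz (σ t) (hσle t ht)])
  have ht₁m : t₁ ∈ Icc 0 t₁ := ⟨ht₁.le, le_rfl⟩
  have h0m : (0 : ℝ) ∈ Icc 0 t₁ := ⟨le_rfl, ht₁.le⟩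
  have hξ0 : ‖ξ 0‖ ≤ 3 * ε := by
    have hσ0 : |σ 0| ≤ ε := by
      rw [hσ 0]; exact ((abs_real_inner_le_norm e _).trans (by rw [he1, one_mul])).trans hY0.le
    have hg0' := hLr4 (σ 0) (hσle 0 h0m)
    have e1 : ξ 0 = (Y 0 - z) - σ 0 • e - g (σ 0) := by rw [hξ 0]
    rw [e1]
    calc ‖(Y 0 - z) - σ 0 • e - g (σ 0)‖ ≤ ‖(Y 0 - z) - σ 0 • e‖ + ‖g (σ 0)‖ := norm_sub_le _ _
      _ ≤ (‖Y 0 - z‖ + ‖σ 0 • e‖) + ‖g (σ 0)‖ := add_le_add (norm_sub_le _ _) le_rfl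
      _ ≤ 3 * ε := by rw [norm_smul, Real.norm_eq_abs, he1, mul_one]; linarith [hY0, hε]
  /- ── the threshold machinery: `cone_of_threshold` with the constant floor `Ψ = 2(Lr)²M₁²/μ` ── -/
  set cst : ℝ := 18 * ρ ^ 2 / μ with hcst
  have hcst0 : 0 ≤ cst := by positivity
  have hcK4 : cst * (1 + K) ≤ μ / 4 := by rw [hcst]; linarith [hρ1, hμ]
  set Ψ : ℝ := 2 * (L * r) ^ 2 / μ * M₁ ^ 2 with hΨ
  have hΨ0 : 0 ≤ Ψ := by positivity
  have hφM : ∀ t ∈ Icc 0 t₁, φ (σ t) ^ 2 ≤ M₁ ^ 2 := fun t ht => by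
    have := hM₁ t ht
    rw [← sq_abs]; exact pow_le_pow_left₀ (abs_nonneg _) this 2
  have hpdI : ∀ s ∈ Icc 0 t₁, pd s ≤ -μ * p s + cst * (p s + m s) + Ψ := by
    intro s hs
    have h1 := hpd s hs
    have h2 : 2 * (L * r) ^ 2 / μ * φ (σ s) ^ 2 ≤ Ψ :=
      mul_le_mul_of_nonneg_left (hφM s hs) (by positivity)
    rw [hcst]; linarith
  have hmdI : ∀ s ∈ Icc 0 t₁, μ * m s - cst * (p s + m s) - Ψ ≤ md s := by
    intro s hs
    have h1 := hmd s hs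
    have h2 : 2 * (L * r) ^ 2 / μ * φ (σ s) ^ 2 ≤ Ψ :=
      mul_le_mul_of_nonneg_left (hφM s hs) (by positivity)
    rw [hcst]; linarith
  have hΘpos : 0 < Θ := by
    rw [hΘ]
    have : 0 ≤ κ * M₁ ^ 2 := by rw [hκ]; positivity
    have : 0 < 9 * (1 + K) * ε ^ 2 := by positivity
    linarith
  have hΘΨ : 8 * (1 + K) * Ψ / μ ≤ Θ := by
    have e1 : 8 * (1 + K) * Ψ / μ = 16 * (1 + K) * (L * r) ^ 2 / μ ^ 2 * M₁ ^ 2 := by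
      rw [hΨ]; field_simp; ring
    have e2 : Θ - 16 * (1 + K) * (L * r) ^ 2 / μ ^ 2 * M₁ ^ 2 =
        512 * η ^ 2 / ((1 - 2 * γ) ^ 2 * μ ^ 2) * M₁ ^ 2 + 9 * (1 + K) * ε ^ 2 := by
      rw [hΘ, hκ]; ring
    have : 0 ≤ 512 * η ^ 2 / ((1 - 2 * γ) ^ 2 * μ ^ 2) * M₁ ^ 2 + 9 * (1 + K) * ε ^ 2 := by positivity
    linarith
  have hκ0 : 0 ≤ κ * M₁ ^ 2 := by rw [hκ]; positivity
  have hΘ0 : p 0 + m 0 ≤ Θ := by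
    rw [hpm 0, hΘ]
    have h1 := pow_le_pow_left₀ (norm_nonneg _) hξ0 2
    have h2 : (3 * ε) ^ 2 = 9 * ε ^ 2 := by ring
    have h3 : 1 * ε ^ 2 ≤ K * ε ^ 2 := mul_le_mul_of_nonneg_right hKge1 (sq_nonneg ε)
    linarith only [h1, h2, h3, hκ0, sq_nonneg ε]
  obtain ⟨hcone₁, hm₁⟩ := cone_of_threshold hKge1 hμ hcst0 hcK4 hΨ0 hΘΨ hΘpos (fun s _ => hp' s)
    (fun s _ => hm' s) (fun s _ => hpnn s) (fun s _ => hmnn s) hpdI hmdI hΘ0 ht hbig t₁ ⟨ht.2, le_rfl⟩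
  /- ── sizes at the exit ── -/
  set σ₁ := σ t₁ with hσ₁
  set ξ₁ := ξ t₁ with hξ₁
  set Γ₁ : EuclideanSpace ℝ (Fin 3) := z + σ₁ • e + g σ₁ with hΓ₁
  have hY₁ : Y t₁ = Γ₁ + ξ₁ := hYΓξ t₁
  have hξsq : 2 * Θ ≤ ‖ξ₁‖ ^ 2 := by rw [← hpm t₁]; linarith [hpnn t₁]
  have hξε : 18 * (1 + K) * ε ^ 2 ≤ ‖ξ₁‖ ^ 2 := by
    have h1 : 2 * Θ = 2 * (κ * M₁ ^ 2) + 18 * (1 + K) * ε ^ 2 := by rw [hΘ]; ring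
    linarith only [hξsq, h1, hκ0]
  have hξη : (32 * M₁ * η / ((1 - 2 * γ) * μ)) ^ 2 ≤ ‖ξ₁‖ ^ 2 := by
    have e1 : (32 * M₁ * η / ((1 - 2 * γ) * μ)) ^ 2 = 2 * (512 * η ^ 2 / ((1 - 2 * γ) ^ 2 * μ ^ 2) * M₁ ^ 2) := by
      field_simp; ring
    have ha : 0 ≤ 16 * (1 + K) * (L * r) ^ 2 / μ ^ 2 * M₁ ^ 2 := by positivity
    have hb' : 0 ≤ 9 * (1 + K) * ε ^ 2 := by positivity
    have h2 : 2 * Θ = 2 * (512 * η ^ 2 / ((1 - 2 * γ) ^ 2 * μ ^ 2) * M₁ ^ 2) +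
        2 * (16 * (1 + K) * (L * r) ^ 2 / μ ^ 2 * M₁ ^ 2) + 2 * (9 * (1 + K) * ε ^ 2) := by
      rw [hΘ, hκ]; ring
    rw [e1]; linarith only [hξsq, h2, ha, hb']
  have hξη' : 32 * M₁ * η / ((1 - 2 * γ) * μ) ≤ ‖ξ₁‖ :=
    (pow_le_pow_iff_left₀ (by positivity) (norm_nonneg _) two_ne_zero).1 hξη
  have hξpos : 0 < ‖ξ₁‖ ^ 2 := by linarith
  /- ── transversal gain ── -/
  have hquad : (1 - 2 * γ) * (μ / 4) * ‖ξ₁‖ ^ 2 ≤ (2 * γ - 1) * ⟪A ξ₁, ξ₁⟫ := by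
    have hAξ₁ : ⟪A ξ₁, ξ₁⟫ ≤ α * p t₁ - μ * m t₁ := hAξ t₁
    have h1 : α * p t₁ ≤ K * μ / 2 * p t₁ := mul_le_mul_of_nonneg_right hKα (hpnn t₁)
    have h2 : μ / 2 * (K * p t₁) ≤ μ / 2 * m t₁ := mul_le_mul_of_nonneg_left hcone₁ (by positivity)
    have h3 : ⟪A ξ₁, ξ₁⟫ ≤ -(μ / 2) * m t₁ := by linarith
    have hpK : p t₁ ≤ K * p t₁ := le_mul_of_one_le_left (hpnn t₁) hKge1
    have h4 : ‖ξ₁‖ ^ 2 ≤ 2 * m t₁ := by rw [← hpm t₁]; linarith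
    have h5 := mul_le_mul_of_nonpos_left h3 (by linarith : 2 * γ - 1 ≤ 0)
    have h6 := mul_le_mul_of_nonneg_left h4 (mul_nonneg h12.le (by positivity : (0:ℝ) ≤ μ / 4))
    linarith
  /- ── the off-node expansion at `Γ₁` ── -/
  have hσ₁r : |σ₁| ≤ r := hσle t₁ ht₁m
  have hΓ₁z : ‖Γ₁ - z‖ ≤ δ := by
    have e1 : Γ₁ - z = σ₁ • e + g σ₁ := by rw [hΓ₁]; abel
    rw [e1]; linarith [hΓz σ₁ hσ₁r]
  have hξ₁δ : ‖ξ₁‖ ≤ δ := (hξle t₁ ht₁m).trans (by linarith)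
  have hVΓ₁ : V Γ₁ = φ σ₁ • e := hpar σ₁ (hσ₁r.trans (by linarith))
  have hφ₁ : |φ σ₁| ≤ M₁ := hM₁ t₁ ht₁m
  have hφ₁r : |φ σ₁| ≤ C₁ * r ^ 2 := by
    have h1 := hφsq σ₁ (hσ₁r.trans (by linarith))
    have h2 : σ₁ ^ 2 ≤ r ^ 2 := by rw [← sq_abs]; exact pow_le_pow_left₀ (abs_nonneg _) hσ₁r 2
    exact h1.trans (mul_le_mul_of_nonneg_left h2 hC₁)
  have hVΓ₁n : ‖V Γ₁‖ ≤ C₁ * r ^ 2 := by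
    rw [hVΓ₁, norm_smul, Real.norm_eq_abs, he1, mul_one]; exact hφ₁r
  have hexp₁ := hexp Γ₁ hΓ₁z ξ₁ hξ₁δ
  rw [← hY₁] at hexp₁
  -- the error coefficient
  have herr : (ν + Cν * ‖V Γ₁‖) * ‖ξ₁‖ ^ 2 ≤ (1 - 2 * γ) * μ / 32 * ‖ξ₁‖ ^ 2 := by
    apply mul_le_mul_of_nonneg_right _ (sq_nonneg _)
    have : Cν * ‖V Γ₁‖ ≤ Cν * C₁ * r ^ 2 := by
      have := mul_le_mul_of_nonneg_left hVΓ₁n hCν; linarith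
    linarith
  -- the linear term
  have hlin : |fderiv ℝ Hb Γ₁ ξ₁| ≤ M₁ * η * ‖ξ₁‖ := by
    have h1 := abs_fderiv_selfSimilarBernoulli_le h hΩz he1 hVΓ₁ (hξe t₁)
    rw [← hHb] at h1
    have hDn : 2 * ‖fderiv ℝ U Γ₁ - fderiv ℝ U z‖ ≤ η :=
      hηU Γ₁ (by rw [mem_closedBall, dist_eq_norm]; exact hΓ₁z)
    calc |fderiv ℝ Hb Γ₁ ξ₁| ≤ |φ σ₁| * (2 * ‖fderiv ℝ U Γ₁ - fderiv ℝ U z‖) * ‖ξ₁‖ := h1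
      _ ≤ M₁ * η * ‖ξ₁‖ := by
          apply mul_le_mul_of_nonneg_right _ (norm_nonneg _)
          exact mul_le_mul hφ₁ hDn (by positivity) hM₁0
  have hlin' : M₁ * η * ‖ξ₁‖ ≤ (1 - 2 * γ) * μ / 32 * ‖ξ₁‖ ^ 2 := by
    -- `M₁ η ≤ (1−2γ)(μ/32)|ξ₁|` from `|ξ₁| ≥ 32 M₁ η/((1−2γ)μ)`
    have h1 : M₁ * η ≤ (1 - 2 * γ) * μ / 32 * ‖ξ₁‖ := by
      have := mul_le_mul_of_nonneg_left hξη' (by positivity : (0:ℝ) ≤ (1 - 2 * γ) * μ / 32)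
      have e1 : (1 - 2 * γ) * μ / 32 * (32 * M₁ * η / ((1 - 2 * γ) * μ)) = M₁ * η := by
        field_simp
      linarith
    have := mul_le_mul_of_nonneg_right h1 (norm_nonneg ξ₁)
    calc M₁ * η * ‖ξ₁‖ ≤ (1 - 2 * γ) * μ / 32 * ‖ξ₁‖ * ‖ξ₁‖ := this
      _ = (1 - 2 * γ) * μ / 32 * ‖ξ₁‖ ^ 2 := by ring
  /- ── the landscape deficit `Hb Γ₁ ≥ Hb z − 3(1−2γ)C₁ε³/2 − 3ρ²C₃ε²/μ²` ── -/
  have hθ : ∀ τ, |τ| ≤ r → 2 * ‖fderiv ℝ U (z + τ • e + g τ) - fderiv ℝ U z‖ * ‖e + g' τ‖ ≤ (1 - 2 * γ) / 2 := by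
    intro τ hτ
    have hmem : z + τ • e + g τ ∈ closedBall z δ := by
      rw [mem_closedBall, dist_eq_norm, show z + τ • e + g τ - z = τ • e + g τ by abel]
      linarith only [hΓz τ hτ, hrδ, hr]
    have h1 := hηU _ hmem
    have h2 : ‖e + g' τ‖ ≤ 1 + 2 * L * r := by
      have h3 : L * |τ| ≤ L * r := mul_le_mul_of_nonneg_left hτ hL
      have h4 : 0 ≤ L * r := mul_nonneg hL hr.le
      calc ‖e + g' τ‖ ≤ ‖e‖ + ‖g' τ‖ := norm_add_le _ _
        _ ≤ 1 + L * |τ| := by rw [he1]; exact add_le_add le_rfl (hg' τ (hτ.trans (by linarith only [hrδ, hr])))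
        _ ≤ 1 + 2 * L * r := by linarith only [h3, h4]
    calc 2 * ‖fderiv ℝ U (z + τ • e + g τ) - fderiv ℝ U z‖ * ‖e + g' τ‖ ≤ η * (1 + 2 * L * r) :=
          mul_le_mul h1 h2 (norm_nonneg _) hη.le
      _ ≤ (1 - 2 * γ) / 2 := hrθ
  have hparr : ∀ τ, |τ| ≤ r → V (z + τ • e + g τ) = φ τ • e := fun τ hτ =>
    hpar τ (hτ.trans (by linarith only [hrδ, hr]))
  have hσr : ∀ t ∈ Icc 0 t₁, |⟪e, Y t - z⟫| ≤ r := fun t ht => by rw [← hσ t]; exact hσle t ht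
  have hdev : ∀ t ∈ Icc 0 t₁, (⟪e, V (Y t)⟫ - φ ⟪e, Y t - z⟫) ^ 2 ≤ 4 * ρ ^ 2 / μ ^ 2 * ‖V (Y t)‖ ^ 2 := by
    intro t ht
    rw [← hσ t]
    exact (norm_transport_ge_of_tube hA b hb hμ hpos_i he1 hAe' (hneg_i (ξ t) (hξe t)) (hE t ht) hρ2).2
  have hdef := landscape_deficit h hγ2 hΩz he1 hge hgd hφc hparr hθ hY ht₁.le hσr hμ hdev hHlt hH0
  simp only [← hσ] at hdef
  rw [← hHb] at hdef
  have hσ0 : |σ 0| ≤ ε := by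
    rw [hσ 0]; exact ((abs_real_inner_le_norm e _).trans (by rw [he1, one_mul])).trans hY0.le
  have hφε : ∀ τ, |τ| ≤ ε → |φ τ| ≤ C₁ * ε ^ 2 := by
    intro τ hτ
    have h1 := hφsq τ (hτ.trans (by linarith only [hεr, hrδ, hr]))
    have h2 : τ ^ 2 ≤ ε ^ 2 := by rw [← sq_abs]; exact pow_le_pow_left₀ (abs_nonneg _) hτ 2
    exact h1.trans (mul_le_mul_of_nonneg_left h2 hC₁)
  have hoff := landscape_offset_le h hγ2 hΩz he1 hg0 hge hgd (by linarith only [hεr, hr] : ε ≤ r)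
    (by positivity : (0:ℝ) ≤ C₁ * ε ^ 2) hparr hθ hφε hσ0
  rw [← hHb] at hoff
  have hoff' : Hb z - 3 * (1 - 2 * γ) * C₁ * ε ^ 3 / 2 ≤ Hb (z + σ 0 • e + g (σ 0)) := by
    have h1 := (abs_le.1 hoff).1
    have h2 : 3 * (1 - 2 * γ) / 2 * (C₁ * ε ^ 2) * |σ 0| ≤ 3 * (1 - 2 * γ) / 2 * (C₁ * ε ^ 2) * ε :=
      mul_le_mul_of_nonneg_left hσ0 (by positivity)
    linarith only [h1, h2]
  have hApos : 0 ≤ (1 - 2 * γ) / 4 * ∫ t in (0:ℝ)..t₁, φ (σ t) ^ 2 := by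
    apply mul_nonneg (by positivity)
    exact intervalIntegral.integral_nonneg ht₁.le fun t _ => sq_nonneg _
  have hland : Hb z - 3 * (1 - 2 * γ) * C₁ * ε ^ 3 / 2 - 3 * ρ ^ 2 * C₃ * ε ^ 2 / μ ^ 2 ≤ Hb Γ₁ := by
    have hG₁ : Hb (z + σ t₁ • e + g (σ t₁)) = Hb Γ₁ := by simp only [hΓ₁, hσ₁]
    linarith only [hdef, hoff', hApos, hG₁]
  /- ── combine: `Hb (Y t₁) > Hb z` ── -/
  have hsmallε : 3 * (1 - 2 * γ) * C₁ * ε ^ 3 / 2 + 3 * ρ ^ 2 * C₃ * ε ^ 2 / μ ^ 2 ≤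
      (1 - 2 * γ) * μ / 32 * ‖ξ₁‖ ^ 2 := by
    have h1 := mul_le_mul_of_nonneg_right hεT (sq_nonneg ε)
    have e1 : (3 * (1 - 2 * γ) * C₁ * ε / 2 + 3 * ρ ^ 2 * C₃ / μ ^ 2) * ε ^ 2 =
        3 * (1 - 2 * γ) * C₁ * ε ^ 3 / 2 + 3 * ρ ^ 2 * C₃ * ε ^ 2 / μ ^ 2 := by ring
    have h2 : (1 - 2 * γ) * μ / 32 * (18 * (1 + K)) * ε ^ 2 ≤ (1 - 2 * γ) * μ / 32 * ‖ξ₁‖ ^ 2 := by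
      have := mul_le_mul_of_nonneg_left hξε (by positivity : (0:ℝ) ≤ (1 - 2 * γ) * μ / 32)
      linarith
    linarith
  have hlinabs := abs_le.1 (hlin.trans hlin')
  have hgainpos : 0 < (1 - 2 * γ) * μ / 32 * ‖ξ₁‖ ^ 2 := by positivity
  have hA' : (1 - 2 * γ) * (μ / 8) * ‖ξ₁‖ ^ 2 ≤ 1 / 2 * ((2 * γ - 1) * ⟪A ξ₁, ξ₁⟫) := by
    linarith only [hquad]
  have hstep : Hb z + (1 - 2 * γ) * μ / 32 * ‖ξ₁‖ ^ 2 ≤ Hb (Y t₁) := by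
    linarith only [hexp₁, herr, hlinabs.1, hA', hland, hsmallε]
  have hfinal : Hb z < Hb (Y t₁) := by linarith only [hstep, hgainpos]
  exact absurd hHlt (not_lt.2 hfinal.le)

end Summit.NavierStokesRegularity.NavierStokesRegularity.Theorems.PowerGaugeEulerLiouville.NodalContinuum
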